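import Summits.AtomisticToContinuum.BoseEinsteinCondensation.Theorems.LatticeODLROOffHalfFilling.Negative.OffHalfFillingPrelim

/-!
# Crux `LatticeODLROOffHalfFilling` — off half filling is forced, part B: the double commutator

Crux-disprover support for `stmt-AtomisticToContinuum-11033`, part 5b (needs 5a
`OffHalfFillingPrelim`). Spin-½ two-site algebra for `S⁺_x = e_x`, `P↓_x` and the XY bond
`hop_{xy}`; the single commutator `[hop_{xy}, S⁺_tot] = P↓_xS⁺_y + P↓_yS⁺_x − ½(S⁺_x + S⁺_y)`
(`hop_mul_sumE_sub`), the bond double commutator (`doubleComm_bond`), and on the torus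
(`L ≥ 3`): `[H_{L,μ}, S³_tot] = 0` (`commute_hmu_totalSpin_two`), `[H_{L,0}, S⁺_tot]`
(`hmu_zero_comm_sumE`), **`[S⁻_tot,[H_{L,0},S⁺_tot]] = Σ_x Σ_i (2 hop − 4 S³S³)(x, x+eᵢ)`**
(`doubleComm_eq`) with the bound `Re⟨ψ, · ψ⟩ ≤ 6|Λ|‖ψ‖²` (`re_doubleComm_le`), and the
symmetrisation inequality `Re⟨ψ,AᴴHAψ⟩ − E₀Re⟨ψ,AᴴAψ⟩ ≤ Re⟨ψ,[Aᴴ,[H,A]]ψ⟩` for ground vectors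
(`re_excess_le_doubleComm`, Koma–Tasaki / Pitaevskii–Stringari). All [folklore].
-/

noncomputable section

namespace Summit.AtomisticToContinuum.BoseEinsteinCondensation.Theorems.LatticeODLROOffHalfFilling.Negative

open Literature.MathematicalPhysics.QuantumLattice Literature.Probability.LatticeModels Matrix Finset
open scoped ComplexOrder BigOperators

section OffHalf

variable {Λ : Type*} [Fintype Λ] [DecidableEq Λ]

/-! #### Two-site algebra: `[hop, S⁺]` and the double commutator `[S⁻_tot, [H₀, S⁺_tot]]` -/

/-- `e eᴴ = 1 − P↓` (`= P↑`). [folklore] -/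
theorem E_mul_conjTranspose (x : Λ) : E x * (E x)ᴴ = 1 - Pd x := by
  rw [E_conjTranspose, E, onSite_mul, Pd, ← onSite_one', ← onSite_sub']
  congr 1
  ext i j
  fin_cases i <;> fin_cases j <;> simp [raise, pDown, Matrix.mul_apply, conjTranspose_apply]

/-- `e P↓ = e`. [folklore] -/
theorem E_mul_Pd (x : Λ) : E x * Pd x = E x := by
  rw [E, Pd, onSite_mul]
  congr 1
  ext i j
  fin_cases i <;> fin_cases j <;> simp [raise, pDown, Matrix.mul_apply]

/-- `P↓ e = 0`. [folklore] -/
theorem Pd_mul_E (x : Λ) : Pd x * E x = 0 := by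
  rw [E, Pd, onSite_mul]
  have : pDown * raise = 0 := by
    ext i j; fin_cases i <;> fin_cases j <;> simp [raise, pDown, Matrix.mul_apply]
  rw [this]
  ext σ τ
  simp [onSite_apply]

/-- `eᴴ P↓ = 0`. [folklore] -/
theorem E_conjTranspose_mul_Pd (x : Λ) : (E x)ᴴ * Pd x = 0 := by
  have h := congrArg conjTranspose (Pd_mul_E x)
  rw [conjTranspose_mul, conjTranspose_zero] at h
  have hP : (Pd x)ᴴ = Pd x := by
    rw [← E_conjTranspose_mul_E, conjTranspose_mul, conjTranspose_conjTranspose]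
  rwa [hP] at h

/-- `P↓ eᴴ = eᴴ`. [folklore] -/
theorem Pd_mul_E_conjTranspose (x : Λ) : Pd x * (E x)ᴴ = (E x)ᴴ := by
  have h := congrArg conjTranspose (E_mul_Pd x)
  rw [conjTranspose_mul] at h
  have hP : (Pd x)ᴴ = Pd x := by
    rw [← E_conjTranspose_mul_E, conjTranspose_mul, conjTranspose_conjTranspose]
  rwa [hP] at h

/-- The bond operator is symmetric in its sites. [folklore] -/
theorem hop_comm (x y : Λ) : hop x y = hop y x := by
  by_cases hxy : x = y
  · subst hxy; rfl
  · rw [hop, hop, (siteSpin_commute_of_ne_holds 1 hxy 0 0).eq,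
      (siteSpin_commute_of_ne_holds 1 hxy 1 1).eq]

/-- **`[hop_{xy}, S⁺_x] = (P↓_x − ½) S⁺_y`** (`x ≠ y`). [folklore] -/
theorem hop_mul_E_sub (x y : Λ) (hxy : x ≠ y) :
    hop x y * E x - E x * hop x y = Pd x * E y - (1 / 2 : ℂ) • E y := by
  have hc1 : (E y)ᴴ * E x = E x * (E y)ᴴ := by
    rw [E_conjTranspose, E, onSite_mul_onSite_comm hxy.symm]
  have hc2 : E y * E x = E x * E y := by rw [E, E, onSite_mul_onSite_comm hxy.symm]
  have m1 : E x * (E y)ᴴ * E x = 0 := by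
    rw [Matrix.mul_assoc, hc1, ← Matrix.mul_assoc, E_mul_E, Matrix.zero_mul]
  have m2 : (E x)ᴴ * E y * E x = Pd x * E y := by
    rw [Matrix.mul_assoc, hc2, ← Matrix.mul_assoc, E_conjTranspose_mul_E]
  have m3 : E x * (E x * (E y)ᴴ) = 0 := by
    rw [← Matrix.mul_assoc, E_mul_E, Matrix.zero_mul]
  have m4 : E x * ((E x)ᴴ * E y) = E y - Pd x * E y := by
    rw [← Matrix.mul_assoc, E_mul_conjTranspose, Matrix.sub_mul, Matrix.one_mul]
  rw [hop_eq, smul_mul_assoc, mul_smul_comm, Matrix.add_mul, Matrix.mul_add, m1, m2, m3, m4]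
  module

/-- `[hop_{xy}, S⁺_y] = (P↓_y − ½) S⁺_x` (`x ≠ y`). [folklore] -/
theorem hop_mul_E_sub' (x y : Λ) (hxy : x ≠ y) :
    hop x y * E y - E y * hop x y = Pd y * E x - (1 / 2 : ℂ) • E x := by
  rw [hop_comm]
  exact hop_mul_E_sub y x hxy.symm

/-- Locality: `hop_{xy}` commutes with every single-site operator away from `x, y`. [folklore] -/
theorem commute_hop_onSite {x y z : Λ} (hxz : x ≠ z) (hyz : y ≠ z) (a : Matrix (Fin 2) (Fin 2) ℂ) :
    Commute (hop x y) (onSite z a : Op Λ 2) := by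
  have hx : ∀ α : Fin 3, Commute (siteSpin 1 x α) (onSite z a : Op Λ 2) := fun α =>
    onSite_mul_onSite_comm hxz _ _
  have hy : ∀ α : Fin 3, Commute (siteSpin 1 y α) (onSite z a : Op Λ 2) := fun α =>
    onSite_mul_onSite_comm hyz _ _
  rw [hop]
  exact ((hx 0).mul_left (hy 0)).add_left ((hx 1).mul_left (hy 1))

/-- **`[hop_{xy}, S⁺_tot] = P↓_xS⁺_y + P↓_yS⁺_x − ½(S⁺_x + S⁺_y)`** (`x ≠ y`). [folklore] -/
theorem hop_mul_sumE_sub (x y : Λ) (hxy : x ≠ y) :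
    hop x y * (∑ z : Λ, E z) - (∑ z : Λ, E z) * hop x y =
      Pd x * E y + Pd y * E x - (1 / 2 : ℂ) • (E x + E y) := by
  rw [Finset.mul_sum, Finset.sum_mul, ← Finset.sum_sub_distrib,
    Finset.sum_eq_add_of_mem x y (Finset.mem_univ x) (Finset.mem_univ y) hxy (fun z _ hz => by
      rw [sub_eq_zero]; exact (commute_hop_onSite hz.1.symm hz.2.symm raise).eq),
    hop_mul_E_sub x y hxy, hop_mul_E_sub' x y hxy]
  module

/-- `[S⁻_x, K_{xy}]` for `K_{xy} = ½(S⁺_x + S⁺_y) − P↓_xS⁺_y − P↓_yS⁺_x` (`x ≠ y`):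
`= (P↓_x − ½) + S⁻_xS⁺_y + P↓_y − 2P↓_yP↓_x`. [folklore] -/
theorem E_conjTranspose_mul_K_sub (x y : Λ) (hxy : x ≠ y) :
    (E x)ᴴ * ((1 / 2 : ℂ) • (E x + E y) - Pd x * E y - Pd y * E x) -
      ((1 / 2 : ℂ) • (E x + E y) - Pd x * E y - Pd y * E x) * (E x)ᴴ =
      Pd x - (1 / 2 : ℂ) • 1 + (E x)ᴴ * E y + Pd y - (2 : ℂ) • (Pd y * Pd x) := by
  -- cross-site commutations
  have c1 : E y * (E x)ᴴ = (E x)ᴴ * E y := by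
    rw [E_conjTranspose, E, onSite_mul_onSite_comm hxy.symm]
  have c2 : Pd y * (E x)ᴴ = (E x)ᴴ * Pd y := by
    rw [E_conjTranspose, Pd, onSite_mul_onSite_comm hxy.symm]
  have c3 : E x * Pd y = Pd y * E x := by rw [E, Pd, onSite_mul_onSite_comm hxy]
  -- monomials, left products
  have l1 : (E x)ᴴ * E x = Pd x := E_conjTranspose_mul_E x
  have l3 : (E x)ᴴ * (Pd x * E y) = 0 := by
    rw [← Matrix.mul_assoc, E_conjTranspose_mul_Pd, Matrix.zero_mul]
  have l4 : (E x)ᴴ * (Pd y * E x) = Pd y * Pd x := by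
    rw [← Matrix.mul_assoc, ← c2, Matrix.mul_assoc, l1]
  -- monomials, right products
  have r1 : E x * (E x)ᴴ = 1 - Pd x := E_mul_conjTranspose x
  have r3 : Pd x * E y * (E x)ᴴ = (E x)ᴴ * E y := by
    rw [Matrix.mul_assoc, c1, ← Matrix.mul_assoc, Pd_mul_E_conjTranspose]
  have r4 : Pd y * E x * (E x)ᴴ = Pd y - Pd y * Pd x := by
    rw [Matrix.mul_assoc, r1, Matrix.mul_sub, Matrix.mul_one]
  rw [Matrix.mul_sub, Matrix.mul_sub, Matrix.sub_mul, Matrix.sub_mul, Matrix.mul_smul,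
    Matrix.smul_mul, Matrix.mul_add, Matrix.add_mul, l1, c1, l3, l4, r1, r3, r4]
  module

/-- **The bond double commutator**: with `K'_{xy} = ½(S⁺_x + S⁺_y) − P↓_xS⁺_y − P↓_yS⁺_x`,
`[S⁻_x + S⁻_y, K'_{xy}] = 2 hop_{xy} − 4 S³_xS³_y` (`x ≠ y`). [folklore] -/
theorem doubleComm_bond (x y : Λ) (hxy : x ≠ y) :
    ((E x)ᴴ + (E y)ᴴ) * ((1 / 2 : ℂ) • (E x + E y) - Pd x * E y - Pd y * E x) -
      ((1 / 2 : ℂ) • (E x + E y) - Pd x * E y - Pd y * E x) * ((E x)ᴴ + (E y)ᴴ) =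
      (2 : ℂ) • hop x y - (4 : ℂ) • (siteSpin 1 x 2 * siteSpin 1 y 2) := by
  have hK : (1 / 2 : ℂ) • (E x + E y) - Pd x * E y - Pd y * E x =
      (1 / 2 : ℂ) • (E y + E x) - Pd y * E x - Pd x * E y := by module
  have h1 := E_conjTranspose_mul_K_sub x y hxy
  have h2 := E_conjTranspose_mul_K_sub y x hxy.symm
  rw [← hK] at h2
  have hPP : Pd x * Pd y = Pd y * Pd x := by rw [Pd, Pd, onSite_mul_onSite_comm hxy]
  have hhop : (E x)ᴴ * E y + (E y)ᴴ * E x = (2 : ℂ) • hop x y := by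
    have c : E x * (E y)ᴴ = (E y)ᴴ * E x := by
      rw [E_conjTranspose, E, onSite_mul_onSite_comm hxy]
    rw [hop_eq, smul_smul, c]
    norm_num
    exact add_comm _ _
  have hS : siteSpin 1 x 2 * siteSpin 1 y 2 =
      (1 / 4 : ℂ) • 1 - (1 / 2 : ℂ) • Pd x - (1 / 2 : ℂ) • Pd y + Pd x * Pd y := by
    rw [siteSpin_two_eq, siteSpin_two_eq]
    simp only [Matrix.sub_mul, Matrix.mul_sub, Matrix.smul_mul, Matrix.mul_smul, Matrix.one_mul,
      Matrix.mul_one]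
    module
  rw [Matrix.add_mul, Matrix.mul_add, add_sub_add_comm, h1, h2, hS, ← hhop, hPP]
  module

/-! #### Torus-level identities: `[H₀, S⁺_tot]`, the double commutator and its `O(|Λ|)` bound -/

/-- `K'_{xy} = ½(S⁺_x + S⁺_y) − P↓_xS⁺_y − P↓_yS⁺_x` commutes with single-site operators away from
`x, y`. [folklore] -/
theorem commute_K_onSite {x y z : Λ} (hxz : x ≠ z) (hyz : y ≠ z) (a : Matrix (Fin 2) (Fin 2) ℂ) :
    Commute ((1 / 2 : ℂ) • (E x + E y) - Pd x * E y - Pd y * E x) (onSite z a : Op Λ 2) := by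
  have hEx : Commute (E x) (onSite z a : Op Λ 2) := onSite_mul_onSite_comm hxz _ _
  have hEy : Commute (E y) (onSite z a : Op Λ 2) := onSite_mul_onSite_comm hyz _ _
  have hPx : Commute (Pd x) (onSite z a : Op Λ 2) := onSite_mul_onSite_comm hxz _ _
  have hPy : Commute (Pd y) (onSite z a : Op Λ 2) := onSite_mul_onSite_comm hyz _ _
  exact (((hEx.add_left hEy).smul_left _).sub_left (hPx.mul_left hEy)).sub_left (hPy.mul_left hEx)

/-- **Quadratic-form bound on one bond**: `Re⟨ψ, (2 hop_{xy} − 4 S³_xS³_y) ψ⟩ ≤ 2‖ψ‖²`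
(`|S^αS^α| ≤ ¼`). [folklore] -/
theorem re_quad_bond_le (x y : Λ) (ψ : TensorIndex Λ 2 → ℂ) :
    (star ψ ⬝ᵥ ((2 : ℂ) • hop x y - (4 : ℂ) • (siteSpin 1 x 2 * siteSpin 1 y 2)) *ᵥ ψ).re ≤
      2 * (star ψ ⬝ᵥ ψ).re := by
  have hq : (((1 : ℕ) : ℂ) / 2) ^ 2 = ((1 / 4 : ℝ) : ℂ) := by push_cast; norm_num
  have hup : ∀ α : Fin 3, (star ψ ⬝ᵥ (siteSpin 1 x α * siteSpin 1 y α) *ᵥ ψ).re ≤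
      1 / 4 * (star ψ ⬝ᵥ ψ).re := by
    intro α
    have h := (posSemidef_sq_smul_one_sub_siteSpin_mul' 1 x y α).dotProduct_mulVec_nonneg ψ
    rw [hq, sub_mulVec, smul_mulVec, one_mulVec, dotProduct_sub, dotProduct_smul, smul_eq_mul] at h
    obtain ⟨hre, -⟩ := Complex.nonneg_iff.mp h
    rw [Complex.sub_re, Complex.re_ofReal_mul] at hre
    push_cast at hre
    linarith
  have hlo : -(star ψ ⬝ᵥ (siteSpin 1 x 2 * siteSpin 1 y 2) *ᵥ ψ).re ≤ 1 / 4 * (star ψ ⬝ᵥ ψ).re := by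
    have h := (posSemidef_sq_smul_one_add_siteSpin_mul' 1 x y 2).dotProduct_mulVec_nonneg ψ
    rw [hq, add_mulVec, smul_mulVec, one_mulVec, dotProduct_add, dotProduct_smul, smul_eq_mul] at h
    obtain ⟨hre, -⟩ := Complex.nonneg_iff.mp h
    rw [Complex.add_re, Complex.re_ofReal_mul] at hre
    push_cast at hre
    linarith
  have h2 : ((2 : ℂ)) = ((2 : ℝ) : ℂ) := by norm_num
  have h4 : ((4 : ℂ)) = ((4 : ℝ) : ℂ) := by norm_num
  rw [sub_mulVec, smul_mulVec, smul_mulVec, dotProduct_sub, dotProduct_smul, dotProduct_smul,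
    smul_eq_mul, smul_eq_mul, Complex.sub_re, h2, h4, Complex.re_ofReal_mul, Complex.re_ofReal_mul,
    hop, add_mulVec, dotProduct_add, Complex.add_re]
  linarith [hup 0, hup 1, hlo]

/-- **Symmetrisation of the excess energy of `A ψ`**: for a ground vector `ψ` of Hermitian `H`,
`Re⟨ψ, Aᴴ H A ψ⟩ − E₀ Re⟨ψ, AᴴA ψ⟩ ≤ Re⟨ψ, [Aᴴ, [H, A]] ψ⟩` (the dropped term is
`⟨Aᴴψ, (H − E₀) Aᴴψ⟩ ≥ 0`; the Koma–Tasaki / Pitaevskii–Stringari inequality). [folklore] -/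
theorem re_excess_le_doubleComm {m : Type*} [Fintype m] [DecidableEq m] {H : Matrix m m ℂ}
    (hH : H.IsHermitian) (A : Matrix m m ℂ) {ψ : m → ℂ} (hψ : ψ ∈ H.groundSpace) :
    (star ψ ⬝ᵥ (Aᴴ * H * A) *ᵥ ψ).re - H.groundEnergy * (star ψ ⬝ᵥ (Aᴴ * A) *ᵥ ψ).re ≤
      (star ψ ⬝ᵥ (Aᴴ * H * A - Aᴴ * A * H - H * A * Aᴴ + A * H * Aᴴ) *ᵥ ψ).re := by
  set E₀ := H.groundEnergy with hE
  have hHψ : H *ᵥ ψ = (E₀ : ℂ) • ψ := (mem_groundSpace_iff H ψ).mp hψ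
  have hψH : star ψ ᵥ* H = (E₀ : ℂ) • star ψ := by
    have h := congrArg star hHψ
    rw [star_mulVec, hH.eq, star_smul] at h
    rw [h, Complex.star_def, Complex.conj_ofReal]
  -- term 2: ⟨ψ, AᴴA H ψ⟩ = E₀ ⟨ψ, AᴴA ψ⟩
  have t2 : star ψ ⬝ᵥ (Aᴴ * A * H) *ᵥ ψ = (E₀ : ℂ) * (star ψ ⬝ᵥ (Aᴴ * A) *ᵥ ψ) := by
    rw [← mulVec_mulVec, hHψ, mulVec_smul, dotProduct_smul, smul_eq_mul]
  -- term 3: ⟨ψ, H A Aᴴ ψ⟩ = E₀ ‖Aᴴψ‖²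
  have t3 : star ψ ⬝ᵥ (H * A * Aᴴ) *ᵥ ψ = (E₀ : ℂ) * (star (Aᴴ *ᵥ ψ) ⬝ᵥ (Aᴴ *ᵥ ψ)) := by
    have hAA : A * Aᴴ = (Aᴴ)ᴴ * Aᴴ := by rw [conjTranspose_conjTranspose]
    rw [Matrix.mul_assoc, ← mulVec_mulVec, dotProduct_mulVec, hψH, smul_dotProduct, smul_eq_mul,
      hAA, star_dotProduct_conjTranspose_mul_mulVec]
  -- term 4: ⟨ψ, A H Aᴴ ψ⟩ = ⟨Aᴴψ, H Aᴴψ⟩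
  have t4 : star ψ ⬝ᵥ (A * H * Aᴴ) *ᵥ ψ = star (Aᴴ *ᵥ ψ) ⬝ᵥ H *ᵥ (Aᴴ *ᵥ ψ) := by
    rw [Matrix.mul_assoc, ← mulVec_mulVec, dotProduct_mulVec, ← mulVec_mulVec]
    congr 1
    rw [← conjTranspose_conjTranspose A, star_mulVec, conjTranspose_conjTranspose,
      conjTranspose_conjTranspose]
  -- positivity of the dropped term
  have hpos : 0 ≤ (star (Aᴴ *ᵥ ψ) ⬝ᵥ H *ᵥ (Aᴴ *ᵥ ψ)).re -
      E₀ * (star (Aᴴ *ᵥ ψ) ⬝ᵥ (Aᴴ *ᵥ ψ)).re := by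
    have h := (posSemidef_sub_of_groundEnergy_le hH (le_refl H.groundEnergy)).dotProduct_mulVec_nonneg
      (Aᴴ *ᵥ ψ)
    rw [sub_mulVec, smul_mulVec, one_mulVec, dotProduct_sub, dotProduct_smul, smul_eq_mul] at h
    obtain ⟨hre, -⟩ := Complex.nonneg_iff.mp h
    rw [Complex.sub_re, Complex.re_ofReal_mul] at hre
    exact hre
  rw [add_mulVec, sub_mulVec, sub_mulVec, dotProduct_add, dotProduct_sub, dotProduct_sub,
    Complex.add_re, Complex.sub_re, Complex.sub_re, t2, t3, t4, Complex.re_ofReal_mul,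
    Complex.re_ofReal_mul]
  linarith

variable (L : ℕ) [NeZero L]

/-- `H_{L,0} = −Σ_x Σ_i hop(x, x+eᵢ)` (`L ≥ 3`). [folklore] -/
theorem hmu_zero_eq (hL : 3 ≤ L) :
    Hmu L 0 = -∑ x : TorusSite 3 L, ∑ i : Fin 3, hop x (x + Pi.single i 1) := by
  rw [Hmu, xxz_eq L hL, Complex.ofReal_zero, zero_smul, sub_zero]

/-- **`U(1)` invariance of the crux Hamiltonian**: `[H_{L,μ}, S³_tot] = 0` (`L ≥ 3`). [folklore] -/
theorem commute_hmu_totalSpin_two (hL : 3 ≤ L) (μ : ℝ) :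
    Commute (Hmu L μ) (totalSpin 1 2 : Op (TorusSite 3 L) 2) := by
  rw [Hmu, xxz_eq L hL]
  refine Commute.sub_left (Commute.neg_left ?_) ((Commute.refl _).smul_left _)
  exact Commute.sum_left _ _ _ fun x _ => Commute.sum_left _ _ _ fun i _ =>
    commute_hop_totalSpin_two _ _

/-- **`[H_{L,0}, S⁺_tot] = Σ_x Σ_i K'(x, x+eᵢ)`** with
`K'_{xy} = ½(S⁺_x + S⁺_y) − P↓_xS⁺_y − P↓_yS⁺_x`. [folklore] -/
theorem hmu_zero_comm_sumE (hL : 3 ≤ L) :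
    Hmu L 0 * (∑ z : TorusSite 3 L, E z) - (∑ z : TorusSite 3 L, E z) * Hmu L 0 =
      ∑ x : TorusSite 3 L, ∑ i : Fin 3,
        ((1 / 2 : ℂ) • (E x + E (x + Pi.single i 1)) - Pd x * E (x + Pi.single i 1) -
          Pd (x + Pi.single i 1) * E x) := by
  have hL2 : 2 ≤ L := by omega
  set Ep : Op (TorusSite 3 L) 2 := ∑ z : TorusSite 3 L, E z with hEp
  rw [hmu_zero_eq L hL, neg_mul, mul_neg, sub_neg_eq_add, neg_add_eq_sub]
  simp only [Finset.sum_mul, Finset.mul_sum, ← Finset.sum_sub_distrib]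
  refine Finset.sum_congr rfl fun x _ => Finset.sum_congr rfl fun i _ => ?_
  have hne : x ≠ x + Pi.single i 1 := fun h => torus_single_ne_zero hL2 i (left_eq_add.mp h)
  rw [← neg_sub, hEp, hop_mul_sumE_sub x _ hne]
  module

/-- **The double commutator `[S⁻_tot, [H_{L,0}, S⁺_tot]] = Σ_x Σ_i (2 hop − 4 S³S³)(x, x+eᵢ)`**
(`L ≥ 3`). [folklore] -/
theorem doubleComm_eq (hL : 3 ≤ L) :
    (∑ z : TorusSite 3 L, E z)ᴴ * (Hmu L 0 * (∑ z : TorusSite 3 L, E z) -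
        (∑ z : TorusSite 3 L, E z) * Hmu L 0) -
      (Hmu L 0 * (∑ z : TorusSite 3 L, E z) - (∑ z : TorusSite 3 L, E z) * Hmu L 0) *
        (∑ z : TorusSite 3 L, E z)ᴴ =
      ∑ x : TorusSite 3 L, ∑ i : Fin 3,
        ((2 : ℂ) • hop x (x + Pi.single i 1) -
          (4 : ℂ) • (siteSpin 1 x 2 * siteSpin 1 (x + Pi.single i 1) 2)) := by
  have hL2 : 2 ≤ L := by omega
  rw [hmu_zero_comm_sumE L hL]
  rw [Finset.mul_sum, Finset.sum_mul, ← Finset.sum_sub_distrib]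
  refine Finset.sum_congr rfl fun x _ => ?_
  rw [Finset.mul_sum, Finset.sum_mul, ← Finset.sum_sub_distrib]
  refine Finset.sum_congr rfl fun i _ => ?_
  have hne : x ≠ x + Pi.single i 1 := fun h => torus_single_ne_zero hL2 i (left_eq_add.mp h)
  set y := x + Pi.single i 1 with hy
  set K := (1 / 2 : ℂ) • (E x + E y) - Pd x * E y - Pd y * E x with hK
  rw [Matrix.conjTranspose_sum, Finset.sum_mul, Finset.mul_sum, ← Finset.sum_sub_distrib,
    Finset.sum_eq_add_of_mem x y (Finset.mem_univ x) (Finset.mem_univ y) hne (fun z _ hz => by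
      rw [sub_eq_zero, E_conjTranspose]
      exact ((commute_K_onSite hz.1.symm hz.2.symm raiseᴴ).eq).symm)]
  have h := doubleComm_bond x y hne
  rw [← hK] at h
  rw [← h, Matrix.add_mul, Matrix.mul_add]
  abel

/-- **`O(|Λ|)` bound on the double commutator**: `Re⟨ψ, [S⁻_tot,[H_{L,0},S⁺_tot]] ψ⟩ ≤ 6|Λ|‖ψ‖²`.
[folklore] -/
theorem re_doubleComm_le (hL : 3 ≤ L) (ψ : TensorIndex (TorusSite 3 L) 2 → ℂ) :
    (star ψ ⬝ᵥ ((∑ z : TorusSite 3 L, E z)ᴴ * (Hmu L 0 * (∑ z : TorusSite 3 L, E z) -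
        (∑ z : TorusSite 3 L, E z) * Hmu L 0) -
      (Hmu L 0 * (∑ z : TorusSite 3 L, E z) - (∑ z : TorusSite 3 L, E z) * Hmu L 0) *
        (∑ z : TorusSite 3 L, E z)ᴴ) *ᵥ ψ).re ≤
      6 * (Fintype.card (TorusSite 3 L) : ℝ) * (star ψ ⬝ᵥ ψ).re := by
  rw [doubleComm_eq L hL, Matrix.sum_mulVec, dotProduct_sum, Complex.re_sum]
  calc ∑ x : TorusSite 3 L, (star ψ ⬝ᵥ (∑ i : Fin 3, ((2 : ℂ) • hop x (x + Pi.single i 1) -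
          (4 : ℂ) • (siteSpin 1 x 2 * siteSpin 1 (x + Pi.single i 1) 2))) *ᵥ ψ).re
      ≤ ∑ x : TorusSite 3 L, 3 * (2 * (star ψ ⬝ᵥ ψ).re) := by
        refine Finset.sum_le_sum fun x _ => ?_
        rw [Matrix.sum_mulVec, dotProduct_sum, Complex.re_sum]
        calc ∑ i : Fin 3, (star ψ ⬝ᵥ ((2 : ℂ) • hop x (x + Pi.single i 1) -
              (4 : ℂ) • (siteSpin 1 x 2 * siteSpin 1 (x + Pi.single i 1) 2)) *ᵥ ψ).re
            ≤ ∑ i : Fin 3, 2 * (star ψ ⬝ᵥ ψ).re :=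
              Finset.sum_le_sum fun i _ => re_quad_bond_le _ _ ψ
          _ = 3 * (2 * (star ψ ⬝ᵥ ψ).re) := by
              rw [Finset.sum_const, Finset.card_univ, Fintype.card_fin, nsmul_eq_mul, Nat.cast_ofNat]
    _ = 6 * (Fintype.card (TorusSite 3 L) : ℝ) * (star ψ ⬝ᵥ ψ).re := by
        rw [Finset.sum_const, Finset.card_univ, nsmul_eq_mul]
        ring

end OffHalf

end Summit.AtomisticToContinuum.BoseEinsteinCondensation.Theorems.LatticeODLROOffHalfFilling.Negative
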